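import Summits.ABC.IUTFork.Cor312LicenceWildInhabitedGenuineK
import Summits.ABC.IUTFork.Cor312ProvKRamified
import Literature.IUT.LogVolume.TensorPacketLicenceCellInhabited
import Literature.IUT.LogVolume.GenuineTowerLocalTypeTate
import Literature.IUT.LogVolume.PilotSlotResidue
import Literature.IUT.LogVolume.WeightDescentExpectation
import Literature.IUT.LogVolume.Corollary22RatPointDictionary
import Literature.IUT.LogVolume.DifferentEstimatesCorollaries
import Literature.IUT.LogVolume.GenuineSupportPrimesBound
import Literature.NumberTheory.NumberFields.RescaledCompletionGaloisTransport
import Literature.IUT.HodgeTheaters.InitialThetaDataKGaloisProofs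
import HarnessLib

/-!
# [IUTchIII] Cor. 3.12, branch C / R-W W1 — the hull licence INHABITED at genuine `K`-level data of an abc TRIPLE `λ = a/c`:
# conjugacy of the bad fibre, the pole orders `h_p = 2·v_p(abc)`, `D_p := e_p − 1`, `ρin := 1`, `ρout := p^{a₀} − e_p·a₀` DISCHARGED —
# what is left per bad prime is the ramification index `e_p` and the integer cells

PROOF-ONLY file (D-0012; 0 definitions, 0 `Prop` facts) of the abc-iut cell — D-0079 RESCUE sub-cell R-W «WINDOW Θ-SIDE INEQUALITY», W1 ROW
DECISIONS (inhabited side, D-0107), seat abc-iut-W-row-2 gen 0 (rows 6–10 of HOME/plan/rescue/R-W/OPEN-10.md); the abc-TRIPLE BRIDGE over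
abc-iut-W-row-1's socket `Cor312LicenceWildInhabitedRealising` / `…GenuineK` (p470548 / `…_pilotDataOfK_of_orders_rat`), consumed BY NAME.
TAKES NO SIDE on [IUTchIII] Cor. 3.12 (S. Mochizuki, *Inter-universal Teichmüller theory III*, kurims manuscript, Cor. 3.12 p. 173–174, Step
(xi-f) p. 184) or on any author: statements about OUR typed objects; the hull-level licence is a STRONGER-THAN-PRINT reading of Step (xi-f);
nothing here bears on the printed GLOBAL inequality or the number-level corollary; the existence of initial Θ-data is NOT claimed. typed ≠
proved; instantiated ≠ endorsed.

WHAT IS PROVED (namespace `Summit.ABC.IUTFork.Cor312Prov`, `X := pilotDataOfK D K` for a collection of initial Θ-data `D` ([IUTchI] Def. 3.1)).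
* `nonempty_algEquiv_kOf_of_finrank_eq_one` — **conjugacy of the fibre, DISCHARGED at `d_mod = 1`**: if `[F_mod : ℚ] = 1` then ANY two
  completions `K_x`, `K_y` at fibre points over the same prime are `ℚ_p`-isomorphic: `K/F_mod` is Galois ([IUTchI] Rmk. 3.1.5,
  `InitialThetaData.isGalois_fieldOfModuli_K`), `F_mod` has ONE place over `p` (`card_placesOver_le_finrank`), so the two places are Galois
  conjugate (abc-iut-w5-d056 `RescaledCompletion.exists_algEquiv_norm_eq_of_under_eq`, Cassels–Fröhlich VII Prop. 1.2 (ii)).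
* `ord_jInv_ratPoint_triple_nonneg_of_not_dvd`, `natCast_dvd_of_placeOf_mem_S_triple` — at an abc triple `j(a/c) = 2⁸(cb+a²)³/(abc)²` is
  regular away from `abc`, so a BAD fibre point lies over a prime `p ∣ abc` (and `p ≠ 2`, `p ≠ l`, abc-iut-C-cert-3 `ne_two_and_ne_l_of_placeOf_mem_S_pilotDataOfK`).
* `exists_not_mem_logUnits_norm_le_rpow_one`, `exists_mem_logUnits_rpow_le_of_turning`, `pred_div_le_differentOrd_of_eq` — the ONE-SIDED local
  inputs of the socket at the trivial values, for ANY proper ultrametric `ℚ_p`-field: a non-member of `log_p(𝒪^×)` of norm `≤ p^{−(1−1)/e}`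
  (this seat's `not_closedBall_one_subset_logUnits`, p470534), a member of norm `p^{−(p^{a₀}−e·a₀)/e}` off the cyclotomic indices (abc-iut-c312-3
  `LogEnvelope.exists_mem_logUnits_norm_eq_envelope`), `(e−1)/e ≤ d` (`sub_one_div_le_differentOrd`).
* **`licence_settingPrVolSharp_pilotDataOfK_triple`** / **`exists_qPinned_and_hull_settingPrVolSharp_pilotDataOfK_triple`** — for
  `j(E) = j(a/c)`, `[F_mod : ℚ] = 1`, Θ- and q-ideles REALISING the pilot divisors: IF at every bad fibre point `x | p` the ramification index is
  pinned `e(K_x/ℚ_p) = e_p` together with a different lower bound `D_p/e_p ≤ d(K_x)` (take `D_p = e_p − 1` for free: `…_triple'`), and for every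
  prime `p ∣ abc`, `p ≠ 2, l` the ARITHMETIC of the row holds — a strict turning point `a₀(p)` of `e_p`, `2l ∣ 2·e_p·v_p(abc)`, and the integer cells
  `e_p·⌊(j²P_p − j·D_p − (j+1)·1)/e_p⌋ + (j+1)·(p^{a₀} − e_p·a₀) ≤ P_p`, `P_p = e_p·v_p(abc)/l`, at every label `j ≤ l⋆` — THEN abc-iut-c312-1's
  `Thm311ToCor312.Licence` and branch C's «∃ ρ qK, QPinned ∧ PilotKummerCompatHull» hold at abc-iut-c312-7's `settingPrVolSharp X …`.
READING (neutral; numbers, not adjectives): for the R-W table's Frey rows the INHABITED verdict needs, per bad prime, ONLY the local ramification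
index `e_p` BY NAME (the exact wild inner radius / different of the N2 numerics drop out wherever the tabulated margin survives `D = e−1`, `ρin = 1`);
`e_p` is pinned one-sidedly by the tree (`e ∣ 60·l` at `p ∉ {2,3,5,l}`, abc-iut-W-neg-1; `15·l`-divisibility from below, `GenuineThetaFieldTateRoot`)
but not yet two-sidedly — that is the residual binder of every W1 row built on this bridge. HONEST SCOPE as in the socket.
[cite: Mochizuki2012, IUTchI Def. 3.1 (b),(c) pp. 61–62, Rmk. 3.1.5 p. 65, Ex. 3.2 (iv) p. 71; IUTchIII Cor. 3.12 Step (xi-f) p. 184; IUTchIV Prop. 1.1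
p. 9, Prop. 1.2 (i)(ii) p. 10, Cor. 2.2 (ii) proof (P5) p. 44–46] [cite: DupuyHilado2025, §3.3, §3.4, §4.9, §4.12] [cite: CasselsFrohlichANT1967,
Ch. VII Prop. 1.2 (ii)] [cite: NeukirchANT1999, Ch. II (5.5)] [cite: SilvermanAEC2009, Prop. III.1.7(b)] [claim: Mochizuki2012, status: disputed]
for every IUT sentence quoted.
-/

noncomputable section

open Set Metric Function NumberField IsDedekindDomain
open scoped Pointwise

namespace Summit.ABC.IUTFork.Cor312Prov

open Thm311 Thm311.Real Cor312 Cor312.Setting Cor312Vol Literature.IUT.LogThetaLattice Literature.IUT.LogVolume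
  Literature.IUT.HodgeTheaters
open Literature.NumberTheory.NumberFields Literature.NumberTheory.GaloisRepresentations.Ultrametric
open Literature.NumberTheory.DiophantineGeometry Literature.NumberTheory.DiophantineGeometry.GenEll

/-! ## §1. One-sided local inputs at the trivial values (any local field) -/

section Local

variable (p : ℕ) [hp : Fact p.Prime] {L : Type} [NontriviallyNormedField L] [instL : NormedAlgebra ℚ_[p] L] [IsUltrametricDist L]
  [ProperSpace L]

include instL in
/-- **`ρin := 1`**: some `z ∉ log_p(𝒪_L^×)` has `‖z‖ ≤ p^{−(1−1)/e} = 1` (the unit ball is never inside `log_p(𝒪^×)`, this seat's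
`not_closedBall_one_subset_logUnits`, [IUTchIV] Prop. 1.4 (ii)). [cite: Mochizuki2012, IUTchIV Prop. 1.4 (ii) p. 13] -/
theorem exists_not_mem_logUnits_norm_le_rpow_one (e : ℕ) :
    ∃ z : L, z ∉ logUnits L ∧ ‖z‖ ≤ (p : ℝ) ^ (-((((1 : ℤ) : ℝ) - 1) / (e : ℝ))) := by
  obtain ⟨z, hz, hzΛ⟩ := Set.not_subset.mp (not_closedBall_one_subset_logUnits p (K := L))
  refine ⟨z, hzΛ, ?_⟩
  rw [mem_closedBall_zero_iff] at hz
  simpa using hz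

include instL in
/-- **`ρout := p^{a₀} − e·a₀`**: for `e(L/ℚ_p) = e` with a STRICT turning point `a₀` (`p^a(p−1) < e` for `a < a₀`, `e < p^{a₀}(p−1)`) some
`z ∈ log_p(𝒪_L^×)` has `p^{−(p^{a₀} − e·a₀)/e} ≤ ‖z‖` (abc-iut-c312-3: the envelope is attained by `log_p(1+ϖ)`). [cite: NeukirchANT1999, Ch. II (5.5)] -/
theorem exists_mem_logUnits_rpow_le_of_turning {e a₀ : ℕ} (he : absRamificationIdx p L = e)
    (hlo : ∀ a < a₀, (p : ℤ) ^ a * ((p : ℤ) - 1) < e) (hhi : (e : ℤ) < (p : ℤ) ^ a₀ * ((p : ℤ) - 1)) :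
    ∃ z ∈ logUnits L, (p : ℝ) ^ (-((((p : ℤ) ^ a₀ - (e : ℤ) * (a₀ : ℤ) : ℤ) : ℝ) / (e : ℝ))) ≤ ‖z‖ := by
  subst he
  obtain ⟨ϖ, hϖ⟩ := exists_isUniformizer (F := L)
  obtain ⟨z, hz, hzn⟩ := LogEnvelope.exists_mem_logUnits_norm_eq_envelope p hϖ hlo hhi
  refine ⟨z, hz, le_of_eq ?_⟩
  rw [hzn, norm_isUniformizer_zpow_eq_rpow p hϖ]

include instL in
/-- **`D := e − 1`**: `(e−1)/e ≤ d(L)` ([IUTchIV] Prop. 1.3 (i), the tree's `sub_one_div_le_differentOrd`). [cite: SerreLocalFields1979, Ch. III §6 Prop. 13] -/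
theorem pred_div_le_differentOrd_of_eq {e : ℕ} (he : absRamificationIdx p L = e) :
    (((e - 1 : ℕ) : ℕ) : ℝ) / (e : ℝ) ≤ differentOrd p L := by
  subst he
  have h1 : 1 ≤ absRamificationIdx p L := absRamificationIdx_pos p L
  rw [Nat.cast_sub h1, Nat.cast_one]
  exact sub_one_div_le_differentOrd p L

end Local

/-! ## §2. The genuine `K`-level datum: conjugacy of the fibre at `d_mod = 1`; bad fibre points of an abc triple lie over `abc` -/

variable {F K Fbar : Type} [Field F] [NumberField F] [Field K] [NumberField K] [Algebra F K] [Field Fbar]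
  [Algebra F Fbar] [Algebra K Fbar] {E : WeierstrassCurve F} [E.IsElliptic] {l : ℕ} {Pb : BadPlacePredicates K}
  (D : InitialThetaData F K Fbar E l Pb)

/-- **CONJUGACY OF THE FIBRE at `d_mod = 1`.** If `[F_mod : ℚ] = 1` then for any two fibre points `x, y` of the index of `pilotDataOfK D K` over a
prime `p` the completions `K_x`, `K_y` (abc-iut-S7's rescaled completions) are `ℚ_p`-isomorphic: `K/F_mod` is Galois ([IUTchI] Rmk. 3.1.5), `F_mod`
has a single place over `p`, and the decomposition of Galois conjugates (Cassels–Fröhlich VII Prop. 1.2 (ii); abc-iut-w5-d056). This is the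
socket's `hiso`, with no bad-place hypothesis. [cite: Mochizuki2012, IUTchI Rmk. 3.1.5 p. 65] [cite: CasselsFrohlichANT1967, Ch. VII Prop. 1.2 (ii)] -/
theorem nonempty_algEquiv_kOf_of_finrank_eq_one (hF : Module.finrank ℚ (fieldOfModuli E) = 1) (pp : Nat.Primes)
    (x y : (thetaIndex (pilotDataOfK D K)).Fibre (.inr pp)) :
    haveI : Fact (pp : ℕ).Prime := ⟨pp.2⟩
    Nonempty (kOf (pilotDataOfK D K) pp.1 x ≃ₐ[ℚ_[pp]] kOf (pilotDataOfK D K) pp.1 y) := by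
  haveI : Fact (pp : ℕ).Prime := ⟨pp.2⟩
  haveI : IsGalois (fieldOfModuli E) K := D.isGalois_fieldOfModuli_K
  have hcard : (placesOver (fieldOfModuli E) (pp : ℕ)).card ≤ 1 := (PilotData.card_placesOver_le_finrank (F := fieldOfModuli E) (pp : ℕ)).trans hF.le
  have hx := finBelow_mem_placesOver (fieldOfModuli E) K (placeOf_mem (pilotDataOfK D K) pp.1 x)
  have hy := finBelow_mem_placesOver (fieldOfModuli E) K (placeOf_mem (pilotDataOfK D K) pp.1 y)
  have hv : finBelow (fieldOfModuli E) K (placeOf (pilotDataOfK D K) pp.1 x) =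
      finBelow (fieldOfModuli E) K (placeOf (pilotDataOfK D K) pp.1 y) := Finset.card_le_one.mp hcard _ hx _ hy
  have hunder : (placeOf (pilotDataOfK D K) pp.1 x).under (𝓞 (fieldOfModuli E)) =
      (placeOf (pilotDataOfK D K) pp.1 y).under (𝓞 (fieldOfModuli E)) := by
    rw [← finBelow_eq_under (fieldOfModuli E) K, ← finBelow_eq_under (fieldOfModuli E) K, hv]
  obtain ⟨g, -⟩ := RescaledCompletion.exists_algEquiv_norm_eq_of_under_eq (F₀ := fieldOfModuli E) (p := (pp : ℕ))
    (placeOf (pilotDataOfK D K) pp.1 x) (placeOf (pilotDataOfK D K) pp.1 y) (natCast_mem_placeOf (pilotDataOfK D K) pp.1 x)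
    (natCast_mem_placeOf (pilotDataOfK D K) pp.1 y) hunder
  exact ⟨g⟩

/-- **`j(a/c)` is regular away from `abc`**: at the place `v` of `ℚ` over a prime `p ∤ abc` of an abc triple `a + b = c`, `0 ≤ ord_v j(a/c)`
(`j(a/c) = 2⁸(cb + a²)³/(abc)²`, abc-iut-S6's `Cor22.jInv_ratPoint_triple`). [cite: SilvermanAEC2009, Prop. III.1.7(b)] -/
theorem ord_jInv_ratPoint_triple_nonneg_of_not_dvd {a b c : ℕ} (habc : IsABCTriple a b c) (v : HeightOneSpectrum (𝓞 ℚ))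
    (hv : ¬ Rat.HeightOneSpectrum.natGenerator v ∣ a * b * c) : 0 ≤ ord ℚ v (Cor22.jInv ((a : ℚ) / c)) := by
  have ha : 0 < a := habc.1
  have hb : 0 < b := habc.2.1
  have hc : 0 < c := by have := habc.2.2.1; omega
  have habc0 : a * b * c ≠ 0 := Nat.mul_ne_zero (Nat.mul_ne_zero ha.ne' hb.ne') hc.ne'
  have hN0 : 256 * (c * b + a * a) ^ 3 ≠ 0 := by positivity
  have hN0' : ((256 * (c * b + a * a) ^ 3 : ℕ) : ℚ) ≠ 0 := by exact_mod_cast hN0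
  have hD0 : (a * b * c) ^ 2 ≠ 0 := pow_ne_zero 2 habc0
  have hD0' : (((a * b * c) ^ 2 : ℕ) : ℚ) ≠ 0 := by exact_mod_cast hD0
  rw [Cor22.jInv_ratPoint_triple habc, div_eq_mul_inv, ord_mul ℚ v hN0' (inv_ne_zero hD0'), ord_inv,
    Cor22.ord_natCast_eq_factorization v hN0, Cor22.ord_natCast_eq_factorization v hD0,
    Nat.factorization_eq_zero_of_not_dvd (fun h => hv ((Rat.HeightOneSpectrum.prime_natGenerator v).dvd_of_dvd_pow h))]
  simp

/-- **A BAD fibre point of the `K`-level datum of an abc triple lies over a prime of `abc`**: `j(E) = j(a/c)`, `x | p` bad ⇒ `p ∣ abc`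
(`ord_x(j_E) < 0` at a bad place, [IUTchI] Def. 3.1 (b); `ord_x = e(x|u)·ord_u` along `K/ℚ`; `j(a/c)` is regular away from `abc`).
[cite: Mochizuki2012, IUTchI Def. 3.1 (b) p. 61] [cite: SilvermanAEC2009, Prop. III.1.7(b)] -/
theorem natCast_dvd_of_placeOf_mem_S_triple {a b c : ℕ} (habc : IsABCTriple a b c) (hj : E.j = ((Cor22.jInv ((a : ℚ) / c) : ℚ) : F))
    (pp : Nat.Primes) (x : (thetaIndex (pilotDataOfK D K)).Fibre (.inr pp))
    (hx : haveI : Fact (pp : ℕ).Prime := ⟨pp.2⟩; placeOf (pilotDataOfK D K) pp.1 x ∈ (pilotDataOfK D K).S) :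
    (pp : ℕ) ∣ a * b * c := by
  haveI : Fact (pp : ℕ).Prime := ⟨pp.2⟩
  set w := placeOf (pilotDataOfK D K) pp.1 x with hwdef
  by_contra hndvd
  have hneg := (pilotDataOfK D K).ord_jE_neg w hx
  have hjK : (pilotDataOfK D K).jE = algebraMap ℚ K (Cor22.jInv ((a : ℚ) / c)) := by
    rw [show (pilotDataOfK D K).jE = algebraMap F K E.j from rfl, hj, map_ratCast, eq_ratCast]
  rw [hjK, Cor22.ord_algebraMap_eq] at hneg
  have hgen := natGenerator_finBelow_placeOf D pp x
  have h0 : 0 ≤ ord ℚ (finBelow ℚ K w) (Cor22.jInv ((a : ℚ) / c)) :=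
    ord_jInv_ratPoint_triple_nonneg_of_not_dvd habc _ (by rw [hgen]; exact hndvd)
  have he : (0 : ℤ) ≤ ((finBelow ℚ K w).asIdeal.ramificationIdx' w.asIdeal : ℤ) := by positivity
  exact absurd hneg (not_lt.mpr (mul_nonneg he h0))

/-! ## §3. The licence / branch-C antecedent at the `K`-level datum of an abc triple, from `(e_p)`, a different bound and the row's arithmetic -/

variable {logv : PadicLogs K} (hlog : LogvAnalytic logv)
  (M : Type) [Field M] [NumberField M]
  (archPk : ∀ (j : (thetaIndex (pilotDataOfK D K)).Label) (vQ : (thetaIndex (pilotDataOfK D K)).VQ),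
    Set ((logShellsDH (pilotDataOfK D K) logv).Packet j vQ))
  (archSub : ∀ (j : (thetaIndex (pilotDataOfK D K)).Label) (v : (thetaIndex (pilotDataOfK D K)).V),
    Set ((logShellsDH (pilotDataOfK D K) logv).Packet j ((thetaIndex (pilotDataOfK D K)).over v)))
  (Ψ : ℤ → ∀ v : (thetaIndex (pilotDataOfK D K)).V, v ∈ (thetaIndex (pilotDataOfK D K)).Vbad →
    Set ((logShellsDH (pilotDataOfK D K) logv).StarPacket v))
  (act : ℤ → ∀ v : (thetaIndex (pilotDataOfK D K)).V, v ∈ (thetaIndex (pilotDataOfK D K)).Vbad →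
    (logShellsDH (pilotDataOfK D K) logv).StarPacket v → Module.End ℚ ((logShellsDH (pilotDataOfK D K) logv).StarPacket v))
  (Mmod : ℤ → ∀ j : (thetaIndex (pilotDataOfK D K)).LabelStar, Set ((logShellsDH (pilotDataOfK D K) logv).GlobalPacket j.1))
  (region : ℤ → ∀ j : (thetaIndex (pilotDataOfK D K)).LabelStar, FinDivisor M → ∀ vQ : (thetaIndex (pilotDataOfK D K)).VQ,
    Set ((logShellsDH (pilotDataOfK D K) logv).Packet j.1 vQ))
  (n : ℤ) {HT : Type} {LogLink : HT → HT → Type} {IsFull : ∀ {s t : HT}, LogLink s t → Prop}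
  (lat : LGPGaussianLogThetaLattice LogLink IsFull)
  {Frd : Type} {IsoF : Frd → Frd → Type} {Ob : Frd → Type} {realify : Frd → Frd} {Strip : Type}
  {IsoS : Strip → Strip → Type} {Mv : ∀ v : (thetaIndex (pilotDataOfK D K)).V, v ∈ (thetaIndex (pilotDataOfK D K)).Vbad → Type}
  [∀ v h, Monoid (Mv v h)]
  (sig : GlobalLGPFrobenioidSignature (thetaIndex (pilotDataOfK D K)).lstar (thetaIndex (pilotDataOfK D K)).V
    (· ∈ (thetaIndex (pilotDataOfK D K)).Vbad) Frd IsoF Ob realify Strip IsoS Mv)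
  (split : SplittingMonoids Mv) {ObΔ : Type} {N : ∀ v : (thetaIndex (pilotDataOfK D K)).V, v ∈ (thetaIndex (pilotDataOfK D K)).Vbad → Type}
  [∀ v h, Monoid (N v h)] (qData : QPilotData ObΔ N)
  (tq : ∀ (pp : Nat.Primes) (x : (thetaIndex (pilotDataOfK D K)).Fibre (.inr pp)),
    haveI : Fact (pp : ℕ).Prime := ⟨pp.2⟩; kOf (pilotDataOfK D K) pp.1 x)
  (t : ∀ (pp : Nat.Primes) (_ : Fin (pilotDataOfK D K).lstar) (x : (thetaIndex (pilotDataOfK D K)).Fibre (.inr pp)),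
    haveI : Fact (pp : ℕ).Prime := ⟨pp.2⟩; kOf (pilotDataOfK D K) pp.1 x)
  (htq0 : ∀ pp x, tq pp x ≠ 0)
  (htq1 : ∀ (pp : Nat.Primes) (x : (thetaIndex (pilotDataOfK D K)).Fibre (.inr pp)),
    haveI : Fact (pp : ℕ).Prime := ⟨pp.2⟩; placeOf (pilotDataOfK D K) pp.1 x ∉ (pilotDataOfK D K).S → ‖tq pp x‖ = 1)
  (col : ℤ → Column (logShellsDH (pilotDataOfK D K) logv))
  (ht0 : ∀ pp i x, t pp i x ≠ 0)
  (ht : ∀ (pp : Nat.Primes) (i : Fin (pilotDataOfK D K).lstar) (x : (thetaIndex (pilotDataOfK D K)).Fibre (.inr pp)),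
    haveI : Fact (pp : ℕ).Prime := ⟨pp.2⟩
    Real.log ‖t pp i x‖ = -((pilotDataOfK D K).thetaPilot i (placeOf (pilotDataOfK D K) pp.1 x)) *
      logNorm K (placeOf (pilotDataOfK D K) pp.1 x) / localDegree K (placeOf (pilotDataOfK D K) pp.1 x))
  (htq : ∀ (pp : Nat.Primes) (x : (thetaIndex (pilotDataOfK D K)).Fibre (.inr pp)),
    haveI : Fact (pp : ℕ).Prime := ⟨pp.2⟩
    Real.log ‖tq pp x‖ = -((pilotDataOfK D K).qPilot (placeOf (pilotDataOfK D K) pp.1 x)) *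
      logNorm K (placeOf (pilotDataOfK D K) pp.1 x) / localDegree K (placeOf (pilotDataOfK D K) pp.1 x))

include ht0 ht htq in
/-- **THE HULL LICENCE INHABITED AT THE `K`-LEVEL DATUM OF AN abc TRIPLE, from `(e_p, D_p)` and the row's arithmetic.** `j(E) = j(a/c)` for an
abc triple `a + b = c`, `[F_mod : ℚ] = 1`; Θ- and q-ideles REALISING the pilot divisors of `X := pilotDataOfK D K`; per prime natural numbers
`e_p, D_p, a₀(p)`. IF (`hloc`) at every BAD fibre point `x | p`: `e(K_x/ℚ_p) = e_p` and `D_p/e_p ≤ d(K_x)`; and (`harith`) for every prime `p ∣ abc`,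
`p ≠ 2`, `p ≠ l`: `a₀(p)` is a STRICT turning point of `e_p` (`p^a(p−1) < e_p` for `a < a₀(p)`, `e_p < p^{a₀(p)}(p−1)`), `2l ∣ e_p·2v_p(abc)`, and at
every label `j = i+1 ≤ l⋆` the integer cell **`e_p·⌊(j²P_p − j·D_p − (j+1))/e_p⌋ + (j+1)·(p^{a₀(p)} − e_p·a₀(p)) ≤ P_p`**,
`P_p = e_p·2v_p(abc)/(2l)` — THEN abc-iut-c312-1's `Thm311ToCor312.Licence` holds at abc-iut-c312-7's `settingPrVolSharp X …`. (abc-iut-W-row-1's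
`licence_settingPrVolSharp_pilotDataOfK_of_orders_rat` with `ρin := 1`, `ρout := p^{a₀} − e·a₀`, `h_p := 2v_p(abc)` (`Cor22.ord_jInv_ratPoint_triple_eq`)
and conjugate fibres, §§1–2.) [cite: Mochizuki2012, IUTchI Def. 3.1 (b),(c) pp. 61–62, Rmk. 3.1.5 p. 65; IUTchIII Cor. 3.12 Step (xi-f) p. 184;
IUTchIV Prop. 1.1 p. 9, Cor. 2.2 (ii) proof p. 44–46] [cite: DupuyHilado2025, §3.3, §3.4, §4.9, §4.12] [claim: Mochizuki2012, status: disputed] -/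
theorem licence_settingPrVolSharp_pilotDataOfK_triple {a b c : ℕ} (habc : IsABCTriple a b c)
    (hj : E.j = ((Cor22.jInv ((a : ℚ) / c) : ℚ) : F)) (hF : Module.finrank ℚ (fieldOfModuli E) = 1) (e Dd a0 : Nat.Primes → ℕ)
    (hloc : ∀ (pp : Nat.Primes) (x : (thetaIndex (pilotDataOfK D K)).Fibre (.inr pp)),
      haveI : Fact (pp : ℕ).Prime := ⟨pp.2⟩
      placeOf (pilotDataOfK D K) pp.1 x ∈ (pilotDataOfK D K).S →
        absRamificationIdx (pp : ℕ) (kOf (pilotDataOfK D K) pp.1 x) = e pp ∧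
        (Dd pp : ℝ) / (e pp : ℝ) ≤ differentOrd (pp : ℕ) (kOf (pilotDataOfK D K) pp.1 x))
    (harith : ∀ pp : Nat.Primes, (pp : ℕ) ∣ a * b * c → (pp : ℕ) ≠ 2 → (pp : ℕ) ≠ l →
      (∀ a' < a0 pp, ((pp : ℕ) : ℤ) ^ a' * (((pp : ℕ) : ℤ) - 1) < e pp) ∧ ((e pp : ℤ) < ((pp : ℕ) : ℤ) ^ (a0 pp) * (((pp : ℕ) : ℤ) - 1)) ∧
      2 * l ∣ e pp * (2 * (a * b * c).factorization pp) ∧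
      ∀ i : Fin (pilotDataOfK D K).lstar,
        (e pp : ℤ) * (((((i : ℕ) + 1 : ℕ) : ℤ) ^ 2 * ((e pp * (2 * (a * b * c).factorization pp) / (2 * l) : ℕ) : ℤ) -
            (((i : ℕ) + 1 : ℕ) : ℤ) * (Dd pp : ℤ) - (((i : ℕ) + 2 : ℕ) : ℤ) * (1 : ℤ)) / (e pp : ℤ)) +
          (((i : ℕ) + 2 : ℕ) : ℤ) * (((pp : ℕ) : ℤ) ^ (a0 pp) - (e pp : ℤ) * (a0 pp : ℤ)) ≤
            ((e pp * (2 * (a * b * c).factorization pp) / (2 * l) : ℕ) : ℤ)) :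
    Thm311ToCor312.Licence
      (settingPrVolSharp (pilotDataOfK D K) hlog M archPk archSub Ψ act Mmod region n lat sig split qData tq t htq0 htq1) := by
  refine licence_settingPrVolSharp_pilotDataOfK_of_orders_rat D hlog M archPk archSub Ψ act Mmod region n lat sig split qData tq t htq0 htq1
    ht0 ht htq (Cor22.jInv ((a : ℚ) / c)) hj e Dd (fun pp => 2 * (a * b * c).factorization pp) (fun _ => 1)
    (fun pp => ((pp : ℕ) : ℤ) ^ (a0 pp) - (e pp : ℤ) * (a0 pp : ℤ)) (fun pp x hx => ?_)
    (fun pp x y _ _ => nonempty_algEquiv_kOf_of_finrank_eq_one D hF pp x y) (fun pp hbad => ?_)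
  · -- the local inputs at a bad fibre point `x | p`
    haveI : Fact (pp : ℕ).Prime := ⟨pp.2⟩
    obtain ⟨he, hD⟩ := hloc pp x hx
    have hdvd := natCast_dvd_of_placeOf_mem_S_triple D habc hj pp x hx
    obtain ⟨h2, hl⟩ := ne_two_and_ne_l_of_placeOf_mem_S_pilotDataOfK D pp x hx
    obtain ⟨hlo, hhi, hdiv, -⟩ := harith pp hdvd h2 hl
    refine ⟨he, hD, exists_not_mem_logUnits_norm_le_rpow_one (pp : ℕ) (e pp),
      exists_mem_logUnits_rpow_le_of_turning (pp : ℕ) he hlo hhi, ?_, hdiv⟩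
    rw [Cor22.ord_jInv_ratPoint_triple_eq habc _ (by rw [natGenerator_finBelow_placeOf D pp x]; exact h2)
      (by rw [natGenerator_finBelow_placeOf D pp x]; exact hdvd), natGenerator_finBelow_placeOf D pp x]
    push_cast
    ring
  · -- the integer cells at a bad prime
    haveI : Fact (pp : ℕ).Prime := ⟨pp.2⟩
    obtain ⟨x, hx⟩ := hbad
    have hdvd := natCast_dvd_of_placeOf_mem_S_triple D habc hj pp x hx
    obtain ⟨h2, hl⟩ := ne_two_and_ne_l_of_placeOf_mem_S_pilotDataOfK D pp x hx
    exact (harith pp hdvd h2 hl).2.2.2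

include ht0 ht htq in
/-- **The same with the different bound DISCHARGED at `D_p = e_p − 1`** (`(e−1)/e ≤ d`, [IUTchIV] Prop. 1.3 (i)): the only local binder left is
**`e(K_x/ℚ_p) = e_p` at the bad fibre points**. [cite: Mochizuki2012, IUTchIV Prop. 1.3 (i) p. 12] [cite: SerreLocalFields1979, Ch. III §6 Prop. 13]
[claim: Mochizuki2012, status: disputed] -/
theorem licence_settingPrVolSharp_pilotDataOfK_triple' {a b c : ℕ} (habc : IsABCTriple a b c)
    (hj : E.j = ((Cor22.jInv ((a : ℚ) / c) : ℚ) : F)) (hF : Module.finrank ℚ (fieldOfModuli E) = 1) (e a0 : Nat.Primes → ℕ)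
    (he : ∀ (pp : Nat.Primes) (x : (thetaIndex (pilotDataOfK D K)).Fibre (.inr pp)),
      haveI : Fact (pp : ℕ).Prime := ⟨pp.2⟩
      placeOf (pilotDataOfK D K) pp.1 x ∈ (pilotDataOfK D K).S → absRamificationIdx (pp : ℕ) (kOf (pilotDataOfK D K) pp.1 x) = e pp)
    (harith : ∀ pp : Nat.Primes, (pp : ℕ) ∣ a * b * c → (pp : ℕ) ≠ 2 → (pp : ℕ) ≠ l →
      (∀ a' < a0 pp, ((pp : ℕ) : ℤ) ^ a' * (((pp : ℕ) : ℤ) - 1) < e pp) ∧ ((e pp : ℤ) < ((pp : ℕ) : ℤ) ^ (a0 pp) * (((pp : ℕ) : ℤ) - 1)) ∧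
      2 * l ∣ e pp * (2 * (a * b * c).factorization pp) ∧
      ∀ i : Fin (pilotDataOfK D K).lstar,
        (e pp : ℤ) * (((((i : ℕ) + 1 : ℕ) : ℤ) ^ 2 * ((e pp * (2 * (a * b * c).factorization pp) / (2 * l) : ℕ) : ℤ) -
            (((i : ℕ) + 1 : ℕ) : ℤ) * (((e pp - 1 : ℕ) : ℕ) : ℤ) - (((i : ℕ) + 2 : ℕ) : ℤ) * (1 : ℤ)) / (e pp : ℤ)) +
          (((i : ℕ) + 2 : ℕ) : ℤ) * (((pp : ℕ) : ℤ) ^ (a0 pp) - (e pp : ℤ) * (a0 pp : ℤ)) ≤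
            ((e pp * (2 * (a * b * c).factorization pp) / (2 * l) : ℕ) : ℤ)) :
    Thm311ToCor312.Licence
      (settingPrVolSharp (pilotDataOfK D K) hlog M archPk archSub Ψ act Mmod region n lat sig split qData tq t htq0 htq1) :=
  licence_settingPrVolSharp_pilotDataOfK_triple D hlog M archPk archSub Ψ act Mmod region n lat sig split qData tq t htq0 htq1 ht0 ht htq
    habc hj hF e (fun pp => e pp - 1) a0 (fun pp x hx => by
      haveI : Fact (pp : ℕ).Prime := ⟨pp.2⟩
      exact ⟨he pp x hx, pred_div_le_differentOrd_of_eq (pp : ℕ) (he pp x hx)⟩) harith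

include ht0 ht htq in
/-- **BRANCH C's PER-DATUM ANTECEDENT «∃ ρ qK, QPinned ∧ PilotKummerCompatHull» INHABITED at the `K`-level datum of an abc triple** (any columns;
hypotheses of `licence_settingPrVolSharp_pilotDataOfK_triple`) — the per-datum instance of the window certificates' `hSHw`-shaped binder HOLDS:
a W1 row of the R-W table on the INHABITED side, modulo the local ramification indices at the bad primes.
[cite: Mochizuki2012, IUTchIII Cor. 3.12 Step (xi-d) p. 183, (xi-f) p. 184] [cite: DupuyHilado2025, §3.3, §3.4, §4.9] [claim: Mochizuki2012, status: disputed] -/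
theorem exists_qPinned_and_hull_settingPrVolSharp_pilotDataOfK_triple {a b c : ℕ} (habc : IsABCTriple a b c)
    (hj : E.j = ((Cor22.jInv ((a : ℚ) / c) : ℚ) : F)) (hF : Module.finrank ℚ (fieldOfModuli E) = 1) (e Dd a0 : Nat.Primes → ℕ)
    (hloc : ∀ (pp : Nat.Primes) (x : (thetaIndex (pilotDataOfK D K)).Fibre (.inr pp)),
      haveI : Fact (pp : ℕ).Prime := ⟨pp.2⟩
      placeOf (pilotDataOfK D K) pp.1 x ∈ (pilotDataOfK D K).S →
        absRamificationIdx (pp : ℕ) (kOf (pilotDataOfK D K) pp.1 x) = e pp ∧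
        (Dd pp : ℝ) / (e pp : ℝ) ≤ differentOrd (pp : ℕ) (kOf (pilotDataOfK D K) pp.1 x))
    (harith : ∀ pp : Nat.Primes, (pp : ℕ) ∣ a * b * c → (pp : ℕ) ≠ 2 → (pp : ℕ) ≠ l →
      (∀ a' < a0 pp, ((pp : ℕ) : ℤ) ^ a' * (((pp : ℕ) : ℤ) - 1) < e pp) ∧ ((e pp : ℤ) < ((pp : ℕ) : ℤ) ^ (a0 pp) * (((pp : ℕ) : ℤ) - 1)) ∧
      2 * l ∣ e pp * (2 * (a * b * c).factorization pp) ∧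
      ∀ i : Fin (pilotDataOfK D K).lstar,
        (e pp : ℤ) * (((((i : ℕ) + 1 : ℕ) : ℤ) ^ 2 * ((e pp * (2 * (a * b * c).factorization pp) / (2 * l) : ℕ) : ℤ) -
            (((i : ℕ) + 1 : ℕ) : ℤ) * (Dd pp : ℤ) - (((i : ℕ) + 2 : ℕ) : ℤ) * (1 : ℤ)) / (e pp : ℤ)) +
          (((i : ℕ) + 2 : ℕ) : ℤ) * (((pp : ℕ) : ℤ) ^ (a0 pp) - (e pp : ℤ) * (a0 pp : ℤ)) ≤
            ((e pp * (2 * (a * b * c).factorization pp) / (2 * l) : ℕ) : ℤ)) :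
    ∃ (ρ' : (∀ v : (thetaIndex (pilotDataOfK D K)).V, v ∈ (thetaIndex (pilotDataOfK D K)).Vbad →
            Set ((logShellsDH (pilotDataOfK D K) logv).StarPacket v)) →
          ∀ (j : (thetaIndex (pilotDataOfK D K)).Label) (vQ : (thetaIndex (pilotDataOfK D K)).VQ),
            Set ((logShellsDH (pilotDataOfK D K) logv).Packet j vQ))
        (qK : ∀ v : (thetaIndex (pilotDataOfK D K)).V, v ∈ (thetaIndex (pilotDataOfK D K)).Vbad →
          Set ((logShellsDH (pilotDataOfK D K) logv).StarPacket v)),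
        QPinned ({ toSituation := situationPrVol (pilotDataOfK D K) hlog M archPk archSub Ψ act Mmod region, col := col } :
            LatticeSituation (thetaIndex (pilotDataOfK D K)))
          (settingPrVolSharp (pilotDataOfK D K) hlog M archPk archSub Ψ act Mmod region n lat sig split qData tq t htq0 htq1) ρ' qK ∧
        PilotKummerCompatHull ({ toSituation := situationPrVol (pilotDataOfK D K) hlog M archPk archSub Ψ act Mmod region, col := col } :
            LatticeSituation (thetaIndex (pilotDataOfK D K)))
          (settingPrVolSharp (pilotDataOfK D K) hlog M archPk archSub Ψ act Mmod region n lat sig split qData tq t htq0 htq1) ρ' qK :=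
  (exists_qPinned_and_hull_settingPrVolSharp_iff_licence (pilotDataOfK D K) hlog M archPk archSub Ψ act Mmod region n lat sig split
    qData tq t htq0 htq1 col (fun pp x => norm_qIdele_le_one_of_realises (pilotDataOfK D K) tq htq0 htq pp x)).2
    (licence_settingPrVolSharp_pilotDataOfK_triple D hlog M archPk archSub Ψ act Mmod region n lat sig split qData tq t htq0 htq1 ht0 ht htq
      habc hj hF e Dd a0 hloc harith)

end Summit.ABC.IUTFork.Cor312Prov

end
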